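import Mathlib.RingTheory.RootsOfUnity.Complex
import Mathlib.Data.Matrix.Mul
import Mathlib.Data.Matrix.Basic
import Mathlib.Algebra.BigOperators.Fin
import Mathlib.Tactic.FieldSimp
import Mathlib.Tactic.LinearCombination
import Literature.Computability.AlgebraicComplexity.MatrixMultiplicationExponent
import HarnessLib

/-!
# The Taft algebra acting on `M_n(K)` and the induced operators on bilinear maps

Topic: `Literature/RingTheory/HopfActions`. Definition request `defn-TaftMatrixAction`
(route `MatrixMultiplication/TaftSchemes`, whose items inline the objects below as `let wt / K / X / St`).

## Content

Fix a field `K`, `n : ℕ` and a parameter `q : K` (in the application `K = ℂ`, `q = ω_n = e^{2πi/n}`,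
`rootOfUnity n`). Taft's `n²`-dimensional Hopf algebra `T_n(q)` (Taft 1971; Montgomery–Schneider 2001,
(1.1); Etingof–Walton 2015, §4.1) is `K⟨g, x ∣ gⁿ = 1, xⁿ = 0, xg = q·gx⟩` with `g` grouplike and `x`
skew-primitive; in the presentation used here `Δx = x ⊗ g + 1 ⊗ x` (a `(1,g)`-skew primitive in the
notation of Etingof–Walton §2.1), `ε(x) = 0`, `S(x) = -x g⁻¹`. It acts on the matrix algebra
`A = M_n(K)` making it a `T_n(q)`-module algebra (Montgomery 1993, Def. 4.1.1):

* `g` acts by the INNER automorphism `taftTwist q = Ad(D)`, `D = taftDiag q n = diag(q⁰, …, q^{n-1})`,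
  i.e. `g(E_{ij}) = q^{i-j} E_{ij}`; the scalar `taftWeight q (i, j) = q^{i-j}` is the weight of the
  matrix unit `E_{ij}` (Montgomery 1993, Ex. 4.1.6: grouplikes act as automorphisms).
* `x` acts by the INNER `(g,1)`-derivation (skew derivation, Montgomery 1993, Ex. 4.1.8; inner in the
  sense of Def. 6.1.1) `taftSkewDer q Y = δ(Y) = Y N - N g(Y)` determined by the nilpotent Jordan block
  `N = taftShift K n = Σ_j E_{j,j+1}`: `δ(AB) = δ(A) g(B) + A δ(B)` (`taftSkewDer_mul`), `δ(1) = 0`,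
  and the Taft relations `g δ = q⁻¹ δ g` (`taftTwist_taftSkewDer`, i.e. `xg = q gx`), `gⁿ = id` when
  `qⁿ = 1` (`taftTwist_iterate_self`).
* The INDUCED OPERATORS on bilinear maps `f : M_n × M_n → M_n` — the action of `g` and `x` on
  `Hom_K(A ⊗ A, A)` for the tensor-product module `A ⊗ A` (Montgomery 1993, Def. 1.8.1) and the usual
  `(h·f)(u) = Σ h₁ f(S(h₂) u)`:
  `(𝒦 f)(A, B) = g(f(g⁻¹A, g⁻¹B))`, `(𝒳 f)(A, B) = δ(f(g⁻¹A, g⁻¹B)) - f(δ g⁻¹A, B) - f(g⁻¹A, δ g⁻¹B)`,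
  written in the coordinate-tensor format of `Literature.Computability.AlgebraicComplexity.matMulTensor`
  (`t a b c` = coefficient of `E_a` in `f(E_b, E_c)`, index type `Fin n × Fin n`): `taftK q t` is the
  diagonal operator `(𝒦 t) a b c = w(a) w(b)⁻¹ w(c)⁻¹ t a b c` and `taftX q t` the explicit six-sum
  index formula (`δ(E_{ij}) = E_{i,j+1} - q^{i-j} E_{i-1,j}` substituted in the three terms). For
  `K = ℂ`, `q = rootOfUnity n` these are, after unfolding, literally the `let K / X` of the route items.
* The encoding `toBilin t` of a tensor as a bilinear map and the BRIDGE THEOREMS `toBilin_taftK`,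
  `toBilin_taftX`: the index formulas are exactly the conceptual operators displayed above
  (`toBilin_matMulTensor`: `⟨n,n,n⟩` encodes `(A, B) ↦ AB`; `toBilin_single_single`: the convention).
* Certificate-shaped predicates: `IsSpanStable op T` (the span of a finite family of tensors is carried
  into itself by `op`, with an explicit coefficient matrix), `IsTaftStableScheme q n r w u v` (a length-`r`
  decomposition of `⟨n,n,n⟩` into triads whose span is `𝒦`- and `𝒳`-stable — a `T_n`-submodule),
  `IsTaftClosedSeed`, `IsTaftInvariant`.

## Theorems (all proved)

`taftK_triad` (𝒦 is diagonal leg by leg), `taftK_iterate_self` (`𝒦ⁿ = id` when `qⁿ = 1`),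
`taftK_matMulTensor` / `taftX_matMulTensor` (matrix multiplication is invariant: `𝒦 m = m`, `𝒳 m = 0` —
Montgomery 1993, Def. 4.1.1 (2) for this action: the weights telescope, resp. the twisted Leibniz rule),
`taftX_taftK` (`𝒳 𝒦 = q · 𝒦 𝒳`, the relation `xg = q gx` on `Hom(A ⊗ A, A)`), the bridge theorems
`toBilin_taftK`, `toBilin_taftX`, `toBilin_matMulTensor`, and the matrix-level relations listed above;
`isPrimitiveRoot_rootOfUnity`, `rootOfUnity_pow_self`.

## Sources

* E. J. Taft, Proc. Nat. Acad. Sci. USA 68 (1971) 2631–2633 [Taft1971] (the algebras `T_n(ω)`).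
* S. Montgomery, *Hopf algebras and their actions on rings*, CBMS 82 (1993): Ex. 1.5.6 (Sweedler's `H_4`,
  Taft's family), Def. 1.8.1, Def. 4.1.1, Ex. 4.1.6, Ex. 4.1.8, Def. 6.1.1 [Montgomery1993Hopf].
* S. Montgomery, H.-J. Schneider, Tsukuba J. Math. 25 (2001) 337–358: (1.1) and §2 (σ-skew derivations,
  `Dσ = μσD`) [MontgomerySchneider2001].
* P. Etingof, C. Walton, *Pointed Hopf actions on fields I*, Transform. Groups 20 (2015), §2.1, §4.1
  [EtingofWalton2014].

## Design choices; what is NOT here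

* General field `K` and parameter `q`; hypotheses `q ≠ 0` / `qⁿ = 1` appear exactly where needed. No
  primitivity is assumed: primitivity of `q` is needed only for `δⁿ = 0` (the relation `xⁿ = 0`, via the
  `q`-binomial theorem and `Nⁿ = 0`), which is NOT proved here, and the abstract Hopf algebra `T_n(q)`
  (as a `HopfAlgebra` instance) is not constructed: this file is the concrete action and its operators.
* `taftX` is DEFINED by the index formula (so that route items unfold to it definitionally) and then
  PROVED equal to the conceptual operator (`toBilin_taftX`; likewise `toBilin_taftK`), so faithfulness of
  the index formula is a theorem, not a convention; the structural theorems `taftX_matMulTensor` (twisted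
  Leibniz) and `taftX_taftK` (the Taft relation) are proved directly on the index formula.
* Junk values: for `q = 0` the weights `0 ^ (z : ℤ)` are `1` or `0` and `g` is not an automorphism; all
  statements needing invertibility carry `q ≠ 0`. For `n = 0` everything is an empty function.
-/

noncomputable section

open scoped BigOperators
open Finset Literature.Computability.AlgebraicComplexity

namespace Literature.RingTheory.HopfActions

variable {K : Type*} [Field K]

/-! ## Weights and the twist `g = Ad(diag(q⁰,…,q^{n-1}))` on `M_n(K)` -/

/-- The weight `w(i, j) = q^{i-j}` of the matrix unit `E_{ij}` under conjugation by
`D = diag(q⁰, …, q^{n-1})`: `D E_{ij} D⁻¹ = q^{i-j} E_{ij}` (the `ℤ_n`-grading of `M_n(K)` induced by the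
grouplike `g ∈ T_n(q)` acting as `Ad D`). [cite: MontgomerySchneider2001, (1.1) and §2] -/
def taftWeight (q : K) {n : ℕ} (p : Fin n × Fin n) : K :=
  q ^ ((p.1 : ℤ) - (p.2 : ℤ))

/-- Unfolding of `taftWeight`. [folklore] -/
theorem taftWeight_apply (q : K) {n : ℕ} (p : Fin n × Fin n) :
    taftWeight q p = q ^ ((p.1 : ℤ) - (p.2 : ℤ)) := rfl

/-- Diagonal matrix units have weight `1`. [folklore] -/
@[simp] theorem taftWeight_diag (q : K) {n : ℕ} (i : Fin n) : taftWeight q (i, i) = 1 := by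
  simp [taftWeight]

/-- Weights are never zero when `q ≠ 0`. [folklore] -/
theorem taftWeight_ne_zero {q : K} (hq : q ≠ 0) {n : ℕ} (p : Fin n × Fin n) : taftWeight q p ≠ 0 :=
  zpow_ne_zero _ hq

/-- `w_{q⁻¹} = w_q⁻¹`: the inverse twist `g⁻¹ = Ad(D⁻¹)` has the inverse weights. [folklore] -/
theorem taftWeight_inv (q : K) {n : ℕ} (p : Fin n × Fin n) :
    taftWeight q⁻¹ p = (taftWeight q p)⁻¹ :=
  inv_zpow _ _

/-- Multiplicativity of weights along a path, `w(i,j) = w(i,l) · w(l,j)` (`q ≠ 0`): the grading is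
compatible with `E_{il} E_{lj} = E_{ij}`. [folklore] -/
theorem taftWeight_trans {q : K} (hq : q ≠ 0) {n : ℕ} (i l j : Fin n) :
    taftWeight q (i, j) = taftWeight q (i, l) * taftWeight q (l, j) := by
  simp only [taftWeight]
  rw [← zpow_add₀ hq]
  congr 1
  ring

/-- If `qⁿ = 1` then every weight is an `n`-th root of unity. [folklore] -/
theorem taftWeight_pow_eq_one {q : K} {n : ℕ} (hqn : q ^ n = 1) (p : Fin n × Fin n) :
    taftWeight q p ^ n = 1 := by
  simp only [taftWeight]
  rw [← zpow_natCast, ← zpow_mul, mul_comm, zpow_mul, zpow_natCast, hqn, one_zpow]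

/-- The diagonal matrix `D = diag(q⁰, q¹, …, q^{n-1})` by which the grouplike generator `g` of the Taft
algebra acts on `M_n(K)` (as the inner automorphism `Ad D`). [cite: MontgomerySchneider2001, (1.1) and §2] -/
def taftDiag (q : K) (n : ℕ) : Matrix (Fin n) (Fin n) K :=
  Matrix.diagonal fun i => q ^ (i : ℕ)

/-- The twist `g = Ad(D)`, `g(Y)_{ij} = q^{i-j} Y_{ij}`: the action of the grouplike generator of `T_n(q)`
on `M_n(K)` (an algebra automorphism of order dividing `n` when `qⁿ = 1`, `q ≠ 0`; Montgomery 1993,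
Ex. 4.1.6). Defined entrywise so that no inverse of `D` is needed; `taftDiag_mul_mul_taftDiag_inv`
identifies it with `Y ↦ D Y D⁻¹`. [cite: Montgomery1993Hopf, Ex. 4.1.6] -/
def taftTwist (q : K) {n : ℕ} (Y : Matrix (Fin n) (Fin n) K) : Matrix (Fin n) (Fin n) K :=
  Matrix.of fun i j => taftWeight q (i, j) * Y i j

/-- Entries of the twist. [folklore] -/
@[simp] theorem taftTwist_apply (q : K) {n : ℕ} (Y : Matrix (Fin n) (Fin n) K) (i j : Fin n) :
    taftTwist q Y i j = taftWeight q (i, j) * Y i j := rfl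

/-- `g = Ad(D)`: `D · Y · D⁻¹ = g(Y)` with `D⁻¹ = diag(q^{-i}) = taftDiag q⁻¹ n` (`q ≠ 0`). [folklore] -/
theorem taftDiag_mul_mul_taftDiag_inv {q : K} (hq : q ≠ 0) {n : ℕ} (Y : Matrix (Fin n) (Fin n) K) :
    taftDiag q n * Y * taftDiag q⁻¹ n = taftTwist q Y := by
  ext i j
  simp only [taftDiag, Matrix.mul_apply, Matrix.diagonal_apply, taftTwist_apply, taftWeight]
  rw [Finset.sum_eq_single j, Finset.sum_eq_single i]
  · simp only [if_true]
    rw [zpow_sub₀ hq, zpow_natCast, zpow_natCast, inv_pow]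
    ring
  · intro l _ hl
    simp [hl.symm]
  · simp
  · intro l _ hl
    simp [hl]
  · simp

/-- `D · D⁻¹ = 1` for `D⁻¹ = taftDiag q⁻¹ n` (`q ≠ 0`). [folklore] -/
theorem taftDiag_mul_taftDiag_inv {q : K} (hq : q ≠ 0) (n : ℕ) :
    taftDiag q n * taftDiag q⁻¹ n = 1 := by
  simp only [taftDiag, Matrix.diagonal_mul_diagonal, inv_pow]
  convert Matrix.diagonal_one with i
  exact mul_inv_cancel₀ (pow_ne_zero _ hq)

/-- `g` is unital: `g(1) = 1`. [folklore] -/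
theorem taftTwist_one (q : K) (n : ℕ) : taftTwist q (1 : Matrix (Fin n) (Fin n) K) = 1 := by
  ext i j
  simp only [taftTwist_apply, Matrix.one_apply]
  split_ifs with h
  · subst h
    simp
  · simp

/-- `g` is multiplicative: `g(AB) = g(A) g(B)` (`q ≠ 0`) — the grouplike `g` acts as an algebra
endomorphism (Montgomery 1993, Ex. 4.1.6). [cite: Montgomery1993Hopf, Ex. 4.1.6] -/
theorem taftTwist_mul {q : K} (hq : q ≠ 0) {n : ℕ} (A B : Matrix (Fin n) (Fin n) K) :
    taftTwist q (A * B) = taftTwist q A * taftTwist q B := by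
  ext i j
  simp only [taftTwist_apply, Matrix.mul_apply, Finset.mul_sum]
  refine Finset.sum_congr rfl fun l _ => ?_
  rw [taftWeight_trans hq i l j]
  ring

/-- `g` is additive. [folklore] -/
theorem taftTwist_sub (q : K) {n : ℕ} (A B : Matrix (Fin n) (Fin n) K) :
    taftTwist q (A - B) = taftTwist q A - taftTwist q B := by
  ext i j
  simp [mul_sub]

/-- `g` commutes with scalars. [folklore] -/
theorem taftTwist_smul (q c : K) {n : ℕ} (A : Matrix (Fin n) (Fin n) K) :
    taftTwist q (c • A) = c • taftTwist q A := by
  ext i j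
  simp only [taftTwist_apply, Matrix.smul_apply, smul_eq_mul]
  ring

/-- Iterates of the twist: `gᵏ(Y)_{ij} = w(i,j)ᵏ Y_{ij}`. [folklore] -/
theorem taftTwist_iterate (q : K) {n : ℕ} (k : ℕ) (Y : Matrix (Fin n) (Fin n) K) :
    (taftTwist q)^[k] Y = Matrix.of fun i j => taftWeight q (i, j) ^ k * Y i j := by
  induction k generalizing Y with
  | zero =>
      ext i j
      simp
  | succ k ih =>
      rw [Function.iterate_succ_apply', ih]
      ext i j
      simp only [taftTwist_apply, Matrix.of_apply, pow_succ]
      ring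

/-- The Taft relation `gⁿ = 1` on `M_n(K)`: if `qⁿ = 1` then `g` has order dividing `n`. [cite: MontgomerySchneider2001, (1.1)] -/
theorem taftTwist_iterate_self {q : K} {n : ℕ} (hqn : q ^ n = 1) (Y : Matrix (Fin n) (Fin n) K) :
    (taftTwist q)^[n] Y = Y := by
  rw [taftTwist_iterate]
  ext i j
  simp [taftWeight_pow_eq_one hqn]

/-! ## The nilpotent `N` and the inner skew derivation `δ(Y) = Y N - N g(Y)` -/

variable (K) in
/-- The nilpotent Jordan block `N = Σ_{j} E_{j,j+1} ∈ M_n(K)` (entry `1` at `(i, i+1)`), the element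
implementing the skew-primitive generator `x` of `T_n(q)` as an inner skew derivation. [folklore] -/
def taftShift (n : ℕ) : Matrix (Fin n) (Fin n) K :=
  Matrix.of fun i j => if (i : ℕ) + 1 = (j : ℕ) then 1 else 0

/-- Entries of `N`. [folklore] -/
@[simp] theorem taftShift_apply {n : ℕ} (i j : Fin n) :
    taftShift K n i j = if (i : ℕ) + 1 = (j : ℕ) then 1 else 0 := rfl

/-- `N` has weight `q⁻¹`: `g(N) = q⁻¹ N` (each `E_{j,j+1}` has weight `q^{-1}`). [folklore] -/
theorem taftTwist_taftShift (q : K) (n : ℕ) : taftTwist q (taftShift K n) = q⁻¹ • taftShift K n := by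
  ext i j
  simp only [taftTwist_apply, taftShift_apply, Matrix.smul_apply, smul_eq_mul]
  split_ifs with h
  · simp only [taftWeight, mul_one]
    have : ((i : ℕ) : ℤ) - ((j : ℕ) : ℤ) = -1 := by omega
    rw [this, zpow_neg, zpow_one]
  · simp

/-- The action of the skew-primitive generator `x ∈ T_n(q)` on `M_n(K)`: the inner twisted derivation
`δ(Y) = Y N - N g(Y)` determined by `N = taftShift`. It is a `(g,1)`-derivation in the sense of
Montgomery 1993, Ex. 4.1.8 (`δ(AB) = δ(A) g(B) + A δ(B)`, matching `Δx = x ⊗ g + 1 ⊗ x`), inner in the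
sense of Def. 6.1.1; on matrix units `δ(E_{ij}) = E_{i,j+1} - q^{i-j} E_{i-1,j}`.
[cite: Montgomery1993Hopf, Ex. 4.1.8] -/
def taftSkewDer (q : K) {n : ℕ} (Y : Matrix (Fin n) (Fin n) K) : Matrix (Fin n) (Fin n) K :=
  Y * taftShift K n - taftShift K n * taftTwist q Y

/-- Unfolding of `δ`. [folklore] -/
theorem taftSkewDer_def (q : K) {n : ℕ} (Y : Matrix (Fin n) (Fin n) K) :
    taftSkewDer q Y = Y * taftShift K n - taftShift K n * taftTwist q Y := rfl

/-- Entry formula: `δ(Y)_{ij} = Σ_l [l+1 = j] Y_{il} - Σ_l [i+1 = l] q^{l-j} Y_{lj}`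
(i.e. `Y_{i,j-1} - q^{i+1-j} Y_{i+1,j}` with out-of-range terms absent). [folklore] -/
theorem taftSkewDer_apply (q : K) {n : ℕ} (Y : Matrix (Fin n) (Fin n) K) (i j : Fin n) :
    taftSkewDer q Y i j =
      (∑ l : Fin n, if (l : ℕ) + 1 = (j : ℕ) then Y i l else 0) -
        ∑ l : Fin n, if (i : ℕ) + 1 = (l : ℕ) then taftWeight q (l, j) * Y l j else 0 := by
  simp only [taftSkewDer, Matrix.sub_apply, Matrix.mul_apply, taftShift_apply, taftTwist_apply,
    mul_ite, mul_one, mul_zero, ite_mul, one_mul, zero_mul]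

/-- `δ` kills the identity: `δ(1) = 0` (`x · 1_A = ε(x) 1_A = 0`, Montgomery 1993, Def. 4.1.1 (3)).
[cite: Montgomery1993Hopf, Def. 4.1.1] -/
theorem taftSkewDer_one (q : K) (n : ℕ) : taftSkewDer q (1 : Matrix (Fin n) (Fin n) K) = 0 := by
  simp [taftSkewDer, taftTwist_one]

/-- The twisted Leibniz rule `δ(AB) = δ(A) g(B) + A δ(B)` (`q ≠ 0`): `x` acts as a `(g,1)`-derivation,
Montgomery 1993, Ex. 4.1.8 — condition 4.1.1 (2) for `Δx = x ⊗ g + 1 ⊗ x`. [cite: Montgomery1993Hopf, Ex. 4.1.8] -/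
theorem taftSkewDer_mul {q : K} (hq : q ≠ 0) {n : ℕ} (A B : Matrix (Fin n) (Fin n) K) :
    taftSkewDer q (A * B) = taftSkewDer q A * taftTwist q B + A * taftSkewDer q B := by
  simp only [taftSkewDer, taftTwist_mul hq, Matrix.sub_mul, Matrix.mul_sub, Matrix.mul_assoc]
  abel

/-- `δ` is additive. [folklore] -/
theorem taftSkewDer_sub (q : K) {n : ℕ} (A B : Matrix (Fin n) (Fin n) K) :
    taftSkewDer q (A - B) = taftSkewDer q A - taftSkewDer q B := by
  simp only [taftSkewDer, taftTwist_sub, Matrix.sub_mul, Matrix.mul_sub]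
  abel

/-- `δ` commutes with scalars. [folklore] -/
theorem taftSkewDer_smul (q c : K) {n : ℕ} (A : Matrix (Fin n) (Fin n) K) :
    taftSkewDer q (c • A) = c • taftSkewDer q A := by
  simp only [taftSkewDer, taftTwist_smul, Matrix.smul_mul, Matrix.mul_smul, smul_sub]

/-- The Taft relation between the two generators on `M_n(K)`: `g ∘ δ = q⁻¹ · δ ∘ g`, i.e.
`δ g = q · g δ` (`xg = q gx`, Montgomery–Schneider 2001, (1.1); `Dσ = μσD` in their §2) (`q ≠ 0`).
[cite: MontgomerySchneider2001, (1.1)] -/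
theorem taftTwist_taftSkewDer {q : K} (hq : q ≠ 0) {n : ℕ} (Y : Matrix (Fin n) (Fin n) K) :
    taftTwist q (taftSkewDer q Y) = q⁻¹ • taftSkewDer q (taftTwist q Y) := by
  simp only [taftSkewDer, taftTwist_sub, taftTwist_mul hq, taftTwist_taftShift, Matrix.mul_smul,
    Matrix.smul_mul, smul_sub]

/-! ## The induced operators `𝒦`, `𝒳` on bilinear maps `M_n × M_n → M_n` in tensor coordinates -/

variable (K) in
/-- The coordinate format of bilinear maps `M_n(K) × M_n(K) → M_n(K)` used by
`Literature.Computability.AlgebraicComplexity.matMulTensor K n n n`: a tensor `t a b c`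
(`a b c : Fin n × Fin n`) is the coefficient of the matrix unit `E_a` in `f(E_b, E_c)`. [folklore] -/
abbrev MatrixTensor (n : ℕ) : Type _ :=
  Fin n × Fin n → Fin n × Fin n → Fin n × Fin n → K

/-- The operator `𝒦` induced by the grouplike `g` on bilinear maps, `(𝒦 f)(A, B) = g(f(g⁻¹A, g⁻¹B))`
(the action of `g` on `Hom_K(M_n ⊗ M_n, M_n)`, tensor product module as in Montgomery 1993, Def. 1.8.1),
in tensor coordinates: since `g` is diagonal on matrix units it is the diagonal operator
`(𝒦 t) a b c = w(a) w(b)⁻¹ w(c)⁻¹ · t a b c`. For `K = ℂ`, `q = rootOfUnity n` this is definitionally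
the `let K` of route `MatrixMultiplication/TaftSchemes`. [folklore] -/
def taftK (q : K) {n : ℕ} (t : MatrixTensor K n) : MatrixTensor K n :=
  fun a b c => taftWeight q a * (taftWeight q b)⁻¹ * (taftWeight q c)⁻¹ * t a b c

/-- Entries of `𝒦 t`. [folklore] -/
theorem taftK_apply (q : K) {n : ℕ} (t : MatrixTensor K n) (a b c : Fin n × Fin n) :
    taftK q t a b c = taftWeight q a * (taftWeight q b)⁻¹ * (taftWeight q c)⁻¹ * t a b c := rfl

/-- The operator `𝒳` induced by the skew-primitive `x` on bilinear maps,
`(𝒳 f)(A, B) = δ(f(g⁻¹A, g⁻¹B)) - f(δ g⁻¹ A, B) - f(g⁻¹A, δ g⁻¹ B)` (the action of `x` on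
`Hom_K(M_n ⊗ M_n, M_n)`, `(x·f)(u) = Σ x₁ f(S(x₂) u)` with `Δx = x ⊗ g + 1 ⊗ x`, `S(x) = -x g⁻¹`), written
out in tensor coordinates using `δ(E_{ij}) = E_{i,j+1} - q^{i-j} E_{i-1,j}` and `g⁻¹(E_b) = w(b)⁻¹ E_b`:
the first line is the coefficient of `E_a` in `δ(f(g⁻¹E_b, g⁻¹E_c))`, the second that in
`-f(δ g⁻¹ E_b, E_c)`, the third that in `-f(g⁻¹E_b, δ g⁻¹ E_c)`. For `K = ℂ`, `q = rootOfUnity n` this is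
definitionally the `let X` of route `MatrixMultiplication/TaftSchemes`. [folklore] -/
def taftX (q : K) {n : ℕ} (t : MatrixTensor K n) : MatrixTensor K n :=
  fun a b c =>
    (taftWeight q b)⁻¹ * (taftWeight q c)⁻¹ *
          ((∑ l : Fin n, if (l : ℕ) + 1 = (a.2 : ℕ) then t (a.1, l) b c else 0) -
            ∑ l : Fin n, if (a.1 : ℕ) + 1 = (l : ℕ) then taftWeight q (l, a.2) * t (l, a.2) b c else 0) -
        (taftWeight q b)⁻¹ *
          ((∑ μ : Fin n, if (b.2 : ℕ) + 1 = (μ : ℕ) then t a (b.1, μ) c else 0) -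
            ∑ k : Fin n, if (k : ℕ) + 1 = (b.1 : ℕ) then taftWeight q b * t a (k, b.2) c else 0) -
      (taftWeight q b)⁻¹ * (taftWeight q c)⁻¹ *
        ((∑ μ : Fin n, if (c.2 : ℕ) + 1 = (μ : ℕ) then t a b (c.1, μ) else 0) -
          ∑ k : Fin n, if (k : ℕ) + 1 = (c.1 : ℕ) then taftWeight q c * t a b (k, c.2) else 0)

/-- Entries of `𝒳 t` (unfolding). [folklore] -/
theorem taftX_apply (q : K) {n : ℕ} (t : MatrixTensor K n) (a b c : Fin n × Fin n) :
    taftX q t a b c =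
      (taftWeight q b)⁻¹ * (taftWeight q c)⁻¹ *
            ((∑ l : Fin n, if (l : ℕ) + 1 = (a.2 : ℕ) then t (a.1, l) b c else 0) -
              ∑ l : Fin n, if (a.1 : ℕ) + 1 = (l : ℕ) then taftWeight q (l, a.2) * t (l, a.2) b c
                else 0) -
          (taftWeight q b)⁻¹ *
            ((∑ μ : Fin n, if (b.2 : ℕ) + 1 = (μ : ℕ) then t a (b.1, μ) c else 0) -
              ∑ k : Fin n, if (k : ℕ) + 1 = (b.1 : ℕ) then taftWeight q b * t a (k, b.2) c else 0) -
        (taftWeight q b)⁻¹ * (taftWeight q c)⁻¹ *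
          ((∑ μ : Fin n, if (c.2 : ℕ) + 1 = (μ : ℕ) then t a b (c.1, μ) else 0) -
            ∑ k : Fin n, if (k : ℕ) + 1 = (c.1 : ℕ) then taftWeight q c * t a b (k, c.2) else 0) :=
  rfl

/-- `𝒦` acts diagonally leg by leg: it sends the triad `w ⊗ u ⊗ v` to the triad
`(w(·) w) ⊗ (w(·)⁻¹ u) ⊗ (w(·)⁻¹ v)`; in particular `𝒦`-iterates of triads are triads. [folklore] -/
theorem taftK_triad (q : K) {n : ℕ} (w u v : Fin n × Fin n → K) :
    taftK q (triad w u v) =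
      triad (fun a => taftWeight q a * w a) (fun b => (taftWeight q b)⁻¹ * u b)
        (fun c => (taftWeight q c)⁻¹ * v c) := by
  funext a b c
  simp only [taftK, triad_apply]
  ring

/-- Iterates of `𝒦`: `(𝒦ᵏ t) a b c = (w(a) w(b)⁻¹ w(c)⁻¹)ᵏ t a b c`. [folklore] -/
theorem taftK_iterate (q : K) {n : ℕ} (k : ℕ) (t : MatrixTensor K n) :
    (taftK q)^[k] t =
      fun a b c => (taftWeight q a * (taftWeight q b)⁻¹ * (taftWeight q c)⁻¹) ^ k * t a b c := by
  induction k generalizing t with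
  | zero =>
      funext a b c
      simp
  | succ k ih =>
      rw [Function.iterate_succ_apply', ih]
      funext a b c
      simp only [taftK, pow_succ]
      ring

/-- Iterates of `𝒦` on a triad are the triads with legs rescaled by powers of the weights. [folklore] -/
theorem taftK_iterate_triad (q : K) {n : ℕ} (k : ℕ) (w u v : Fin n × Fin n → K) :
    (taftK q)^[k] (triad w u v) =
      triad (fun a => taftWeight q a ^ k * w a) (fun b => ((taftWeight q b)⁻¹) ^ k * u b)
        (fun c => ((taftWeight q c)⁻¹) ^ k * v c) := by
  rw [taftK_iterate]
  funext a b c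
  simp only [triad_apply, mul_pow]
  ring

/-- `𝒦ⁿ = id` when `qⁿ = 1` (the Taft relation `gⁿ = 1` on `Hom(M_n ⊗ M_n, M_n)`). [cite: MontgomerySchneider2001, (1.1)] -/
theorem taftK_iterate_self {q : K} {n : ℕ} (hqn : q ^ n = 1) (t : MatrixTensor K n) :
    (taftK q)^[n] t = t := by
  rw [taftK_iterate]
  funext a b c
  rw [mul_pow, mul_pow, inv_pow, inv_pow, taftWeight_pow_eq_one hqn, taftWeight_pow_eq_one hqn,
    taftWeight_pow_eq_one hqn]
  simp

/-- Matrix multiplication is `𝒦`-invariant: `𝒦 ⟨n,n,n⟩ = ⟨n,n,n⟩` (`q ≠ 0`) — on the support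
`((κ,ν),(κ,μ),(μ,ν))` the weights telescope, `w(κ,ν) = w(κ,μ) w(μ,ν)`; equivalently `g(AB) = g(A)g(B)`.
[cite: Montgomery1993Hopf, Def. 4.1.1 and Ex. 4.1.6] -/
theorem taftK_matMulTensor {q : K} (hq : q ≠ 0) (n : ℕ) :
    taftK q (matMulTensor K n n n) = matMulTensor K n n n := by
  funext a b c
  obtain ⟨a1, a2⟩ := a
  obtain ⟨b1, b2⟩ := b
  obtain ⟨c1, c2⟩ := c
  simp only [taftK, matMulTensor]
  split_ifs with h
  · obtain ⟨rfl, rfl, rfl⟩ := h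
    rw [taftWeight_trans hq a1 b2 a2, mul_one]
    field_simp [taftWeight_ne_zero hq (a1, b2), taftWeight_ne_zero hq (b2, a2)]
  · simp

/-- Matrix multiplication is killed by `𝒳`: `𝒳 ⟨n,n,n⟩ = 0` (`q ≠ 0`) — the coordinate form of the
twisted Leibniz rule `δ(g⁻¹A · g⁻¹B) = δ(g⁻¹A) B + g⁻¹A δ(g⁻¹B)`, i.e. `x · m = ε(x) m = 0`: the
multiplication of the module algebra `M_n(K)` is a `T_n(q)`-module map (Montgomery 1993, Def. 4.1.1 (2)).
[cite: Montgomery1993Hopf, Def. 4.1.1 and Ex. 4.1.8] -/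
theorem taftX_matMulTensor {q : K} (hq : q ≠ 0) (n : ℕ) :
    taftX q (matMulTensor K n n n) = 0 := by
  have hw : ∀ p : Fin n × Fin n, taftWeight q p ≠ 0 := taftWeight_ne_zero hq
  funext a b c
  obtain ⟨a1, a2⟩ := a
  obtain ⟨b1, b2⟩ := b
  obtain ⟨c1, c2⟩ := c
  -- the six shifted sums of `m = ⟨n,n,n⟩`, each collapsing to a single indicator
  have e1 : (∑ l : Fin n, if (l : ℕ) + 1 = (a2 : ℕ) then matMulTensor K n n n (a1, l) (b1, b2) (c1, c2)
        else 0) = if (c2 : ℕ) + 1 = (a2 : ℕ) ∧ a1 = b1 ∧ b2 = c1 then 1 else 0 := by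
    rw [Finset.sum_eq_single c2]
    · by_cases h : (c2 : ℕ) + 1 = (a2 : ℕ) <;> simp [matMulTensor, h]
    · intro l _ hl
      simp [matMulTensor, hl]
    · simp
  have e2 : (∑ l : Fin n, if (a1 : ℕ) + 1 = (l : ℕ) then
        taftWeight q (l, a2) * matMulTensor K n n n (l, a2) (b1, b2) (c1, c2) else 0) =
        if (a1 : ℕ) + 1 = (b1 : ℕ) ∧ b2 = c1 ∧ a2 = c2 then taftWeight q (b1, a2) else 0 := by
    rw [Finset.sum_eq_single b1]
    · by_cases h : (a1 : ℕ) + 1 = (b1 : ℕ) <;> simp [matMulTensor, h]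
    · intro l _ hl
      simp [matMulTensor, hl]
    · simp
  have e3 : (∑ μ : Fin n, if (b2 : ℕ) + 1 = (μ : ℕ) then matMulTensor K n n n (a1, a2) (b1, μ) (c1, c2)
        else 0) = if a1 = b1 ∧ (b2 : ℕ) + 1 = (c1 : ℕ) ∧ a2 = c2 then 1 else 0 := by
    rw [Finset.sum_eq_single c1]
    · by_cases h : (b2 : ℕ) + 1 = (c1 : ℕ) <;> simp [matMulTensor, h]
    · intro l _ hl
      simp [matMulTensor, hl]
    · simp
  have e4 : (∑ k : Fin n, if (k : ℕ) + 1 = (b1 : ℕ) then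
        taftWeight q (b1, b2) * matMulTensor K n n n (a1, a2) (k, b2) (c1, c2) else 0) =
        if (a1 : ℕ) + 1 = (b1 : ℕ) ∧ b2 = c1 ∧ a2 = c2 then taftWeight q (b1, b2) else 0 := by
    rw [Finset.sum_eq_single a1]
    · by_cases h : (a1 : ℕ) + 1 = (b1 : ℕ) <;> simp [matMulTensor, h]
    · intro l _ hl
      simp [matMulTensor, Ne.symm hl]
    · simp
  have e5 : (∑ μ : Fin n, if (c2 : ℕ) + 1 = (μ : ℕ) then matMulTensor K n n n (a1, a2) (b1, b2) (c1, μ)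
        else 0) = if (c2 : ℕ) + 1 = (a2 : ℕ) ∧ a1 = b1 ∧ b2 = c1 then 1 else 0 := by
    rw [Finset.sum_eq_single a2]
    · by_cases h : (c2 : ℕ) + 1 = (a2 : ℕ) <;> simp [matMulTensor, h]
    · intro l _ hl
      simp [matMulTensor, Ne.symm hl]
    · simp
  have e6 : (∑ k : Fin n, if (k : ℕ) + 1 = (c1 : ℕ) then
        taftWeight q (c1, c2) * matMulTensor K n n n (a1, a2) (b1, b2) (k, c2) else 0) =
        if a1 = b1 ∧ (b2 : ℕ) + 1 = (c1 : ℕ) ∧ a2 = c2 then taftWeight q (c1, c2) else 0 := by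
    rw [Finset.sum_eq_single b2]
    · by_cases h : (b2 : ℕ) + 1 = (c1 : ℕ) <;> simp [matMulTensor, h]
    · intro l _ hl
      simp [matMulTensor, Ne.symm hl]
    · simp
  simp only [taftX, e1, e2, e3, e4, e5, e6, Pi.zero_apply]
  -- the two surviving pairs cancel by the weight identities
  have k2 : (taftWeight q (b1, b2))⁻¹ * (taftWeight q (c1, c2))⁻¹ *
        (if (a1 : ℕ) + 1 = (b1 : ℕ) ∧ b2 = c1 ∧ a2 = c2 then taftWeight q (b1, a2) else 0) =
      (taftWeight q (b1, b2))⁻¹ *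
        (if (a1 : ℕ) + 1 = (b1 : ℕ) ∧ b2 = c1 ∧ a2 = c2 then taftWeight q (b1, b2) else 0) := by
    split_ifs with h
    · obtain ⟨-, rfl, rfl⟩ := h
      rw [taftWeight_trans hq b1 b2 a2]
      field_simp [hw (b1, b2), hw (b2, a2)]
    · simp
  have k3 : (taftWeight q (b1, b2))⁻¹ *
        (if a1 = b1 ∧ (b2 : ℕ) + 1 = (c1 : ℕ) ∧ a2 = c2 then (1 : K) else 0) =
      (taftWeight q (b1, b2))⁻¹ * (taftWeight q (c1, c2))⁻¹ *
        (if a1 = b1 ∧ (b2 : ℕ) + 1 = (c1 : ℕ) ∧ a2 = c2 then taftWeight q (c1, c2) else 0) := by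
    split_ifs with h
    · field_simp [hw (b1, b2), hw (c1, c2)]
    · simp
  linear_combination (-1 : K) * k2 + (-1 : K) * k3

/-- The Taft relation on bilinear maps: `𝒳 ∘ 𝒦 = q · 𝒦 ∘ 𝒳` (`q ≠ 0`), i.e. `xg = q gx` acting on
`Hom_K(M_n ⊗ M_n, M_n)`; in coordinates each of the six shifted sums picks up exactly one factor `q`
because `δ` lowers weights by one step (`g δ = q⁻¹ δ g`). [cite: MontgomerySchneider2001, (1.1)] -/
theorem taftX_taftK {q : K} (hq : q ≠ 0) {n : ℕ} (t : MatrixTensor K n) :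
    taftX q (taftK q t) = q • taftK q (taftX q t) := by
  funext a b c
  obtain ⟨a1, a2⟩ := a
  obtain ⟨b1, b2⟩ := b
  obtain ⟨c1, c2⟩ := c
  simp only [taftX, taftK, Pi.smul_apply, smul_eq_mul]
  -- abbreviation for the diagonal multiplier of `𝒦` at `(a, b, c)`
  set W : K := taftWeight q (a1, a2) * (taftWeight q (b1, b2))⁻¹ * (taftWeight q (c1, c2))⁻¹ with hW
  have s1 : (∑ l : Fin n, if (l : ℕ) + 1 = (a2 : ℕ) then
        taftWeight q (a1, l) * (taftWeight q (b1, b2))⁻¹ * (taftWeight q (c1, c2))⁻¹ *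
          t (a1, l) (b1, b2) (c1, c2) else 0) =
      q * W * ∑ l : Fin n, if (l : ℕ) + 1 = (a2 : ℕ) then t (a1, l) (b1, b2) (c1, c2) else 0 := by
    rw [Finset.mul_sum]
    refine Finset.sum_congr rfl fun l _ => ?_
    split_ifs with h
    · have e : taftWeight q (a1, l) = taftWeight q (a1, a2) * q := by
        simp only [taftWeight]
        rw [← zpow_add_one₀ hq]
        congr 1
        omega
      rw [e, hW]
      ring
    · simp
  have s2 : (∑ l : Fin n, if (a1 : ℕ) + 1 = (l : ℕ) then
        taftWeight q (l, a2) * (taftWeight q (l, a2) * (taftWeight q (b1, b2))⁻¹ *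
          (taftWeight q (c1, c2))⁻¹ * t (l, a2) (b1, b2) (c1, c2)) else 0) =
      q * W * ∑ l : Fin n, if (a1 : ℕ) + 1 = (l : ℕ) then
        taftWeight q (l, a2) * t (l, a2) (b1, b2) (c1, c2) else 0 := by
    rw [Finset.mul_sum]
    refine Finset.sum_congr rfl fun l _ => ?_
    split_ifs with h
    · have e : taftWeight q (l, a2) = taftWeight q (a1, a2) * q := by
        simp only [taftWeight]
        rw [← zpow_add_one₀ hq]
        congr 1
        omega
      rw [e, hW]
      ring
    · simp
  have s3 : (∑ μ : Fin n, if (b2 : ℕ) + 1 = (μ : ℕ) then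
        taftWeight q (a1, a2) * (taftWeight q (b1, μ))⁻¹ * (taftWeight q (c1, c2))⁻¹ *
          t (a1, a2) (b1, μ) (c1, c2) else 0) =
      q * W * ∑ μ : Fin n, if (b2 : ℕ) + 1 = (μ : ℕ) then t (a1, a2) (b1, μ) (c1, c2) else 0 := by
    rw [Finset.mul_sum]
    refine Finset.sum_congr rfl fun μ _ => ?_
    split_ifs with h
    · have e : taftWeight q (b1, b2) = taftWeight q (b1, μ) * q := by
        simp only [taftWeight]
        rw [← zpow_add_one₀ hq]
        congr 1
        omega
      rw [hW, e]
      field_simp [taftWeight_ne_zero hq (b1, μ)]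
    · simp
  have s4 : (∑ k : Fin n, if (k : ℕ) + 1 = (b1 : ℕ) then
        taftWeight q (b1, b2) * (taftWeight q (a1, a2) * (taftWeight q (k, b2))⁻¹ *
          (taftWeight q (c1, c2))⁻¹ * t (a1, a2) (k, b2) (c1, c2)) else 0) =
      q * W * ∑ k : Fin n, if (k : ℕ) + 1 = (b1 : ℕ) then
        taftWeight q (b1, b2) * t (a1, a2) (k, b2) (c1, c2) else 0 := by
    rw [Finset.mul_sum]
    refine Finset.sum_congr rfl fun k _ => ?_
    split_ifs with h
    · have e : taftWeight q (b1, b2) = taftWeight q (k, b2) * q := by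
        simp only [taftWeight]
        rw [← zpow_add_one₀ hq]
        congr 1
        omega
      rw [hW, e]
      field_simp [taftWeight_ne_zero hq (k, b2)]
    · simp
  have s5 : (∑ μ : Fin n, if (c2 : ℕ) + 1 = (μ : ℕ) then
        taftWeight q (a1, a2) * (taftWeight q (b1, b2))⁻¹ * (taftWeight q (c1, μ))⁻¹ *
          t (a1, a2) (b1, b2) (c1, μ) else 0) =
      q * W * ∑ μ : Fin n, if (c2 : ℕ) + 1 = (μ : ℕ) then t (a1, a2) (b1, b2) (c1, μ) else 0 := by
    rw [Finset.mul_sum]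
    refine Finset.sum_congr rfl fun μ _ => ?_
    split_ifs with h
    · have e : taftWeight q (c1, c2) = taftWeight q (c1, μ) * q := by
        simp only [taftWeight]
        rw [← zpow_add_one₀ hq]
        congr 1
        omega
      rw [hW, e]
      field_simp [taftWeight_ne_zero hq (c1, μ)]
    · simp
  have s6 : (∑ k : Fin n, if (k : ℕ) + 1 = (c1 : ℕ) then
        taftWeight q (c1, c2) * (taftWeight q (a1, a2) * (taftWeight q (b1, b2))⁻¹ *
          (taftWeight q (k, c2))⁻¹ * t (a1, a2) (b1, b2) (k, c2)) else 0) =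
      q * W * ∑ k : Fin n, if (k : ℕ) + 1 = (c1 : ℕ) then
        taftWeight q (c1, c2) * t (a1, a2) (b1, b2) (k, c2) else 0 := by
    rw [Finset.mul_sum]
    refine Finset.sum_congr rfl fun k _ => ?_
    split_ifs with h
    · have e : taftWeight q (c1, c2) = taftWeight q (k, c2) * q := by
        simp only [taftWeight]
        rw [← zpow_add_one₀ hq]
        congr 1
        omega
      rw [hW, e]
      field_simp [taftWeight_ne_zero hq (k, c2)]
    · simp
  rw [s1, s2, s3, s4, s5, s6, hW]
  ring

/-! ## The tensor encoding of bilinear maps: `𝒦` and `𝒳` ARE the induced operators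

`toBilin t` is the bilinear map `M_n × M_n → M_n` encoded by the tensor `t` (the convention of
`matMulTensor`: `t a b c` is the coefficient of `E_a` in `f(E_b, E_c)`, `toBilin_single_single`,
and `toBilin ⟨n,n,n⟩ (A, B) = AB`, `toBilin_matMulTensor`). The theorems `toBilin_taftK` and
`toBilin_taftX` certify that the index formulas `taftK`, `taftX` are exactly the conceptual operators
`f ↦ g ∘ f ∘ (g⁻¹ × g⁻¹)` and `f ↦ δ ∘ f ∘ (g⁻¹ × g⁻¹) - f ∘ (δ g⁻¹ × id) - f ∘ (g⁻¹ × δ g⁻¹)`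
(`g⁻¹ = taftTwist q⁻¹`). -/

/-- The bilinear map `M_n(K) × M_n(K) → M_n(K)` encoded by a tensor `t` in the format of `matMulTensor`:
`f_t(A, B)_{a} = Σ_{b,c} t a b c · A_b · B_c`. [folklore] -/
def toBilin {n : ℕ} (t : MatrixTensor K n) (A B : Matrix (Fin n) (Fin n) K) : Matrix (Fin n) (Fin n) K :=
  Matrix.of fun i j => ∑ b : Fin n × Fin n, ∑ c : Fin n × Fin n, t (i, j) b c * A b.1 b.2 * B c.1 c.2

/-- Entries of `toBilin t A B`. [folklore] -/
theorem toBilin_apply {n : ℕ} (t : MatrixTensor K n) (A B : Matrix (Fin n) (Fin n) K) (i j : Fin n) :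
    toBilin t A B i j = ∑ b : Fin n × Fin n, ∑ c : Fin n × Fin n, t (i, j) b c * A b.1 b.2 * B c.1 c.2 :=
  rfl

/-- The encoding convention: on matrix units, `f_t(E_b, E_c)_a = t a b c`. [folklore] -/
theorem toBilin_single_single {n : ℕ} (t : MatrixTensor K n) (b c : Fin n × Fin n) (i j : Fin n) :
    toBilin t (Matrix.single b.1 b.2 1) (Matrix.single c.1 c.2 1) i j = t (i, j) b c := by
  rw [toBilin_apply, Finset.sum_eq_single b, Finset.sum_eq_single c]
  · simp
  · intro c' _ hc
    have : ¬(c.1 = c'.1 ∧ c.2 = c'.2) := fun h => hc (Prod.ext h.1.symm h.2.symm)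
    simp [this]
  · simp
  · intro b' _ hb
    have : ¬(b.1 = b'.1 ∧ b.2 = b'.2) := fun h => hb (Prod.ext h.1.symm h.2.symm)
    simp [Matrix.single_apply, this]
  · simp

/-- `⟨n,n,n⟩` encodes matrix multiplication: `f_{⟨n,n,n⟩}(A, B) = A · B`. [cite: Blaser2013, §5] -/
theorem toBilin_matMulTensor (n : ℕ) (A B : Matrix (Fin n) (Fin n) K) :
    toBilin (matMulTensor K n n n) A B = A * B := by
  ext i j
  rw [toBilin_apply, Matrix.mul_apply, Fintype.sum_prod_type, Finset.sum_eq_single i]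
  · refine Finset.sum_congr rfl fun l _ => ?_
    rw [Fintype.sum_prod_type, Finset.sum_eq_single l, Finset.sum_eq_single j]
    · simp [matMulTensor]
    · intro c2 _ hc
      simp [matMulTensor, Ne.symm hc]
    · simp
    · intro c1 _ hc
      simp [matMulTensor, Ne.symm hc]
    · simp
  · intro b1 _ hb
    simp [matMulTensor, Ne.symm hb]
  · simp

/-- `𝒦` is the operator induced by `g`: `f_{𝒦 t}(A, B) = g(f_t(g⁻¹A, g⁻¹B))` with `g⁻¹ = taftTwist q⁻¹`.
[folklore] -/
theorem toBilin_taftK (q : K) {n : ℕ} (t : MatrixTensor K n) (A B : Matrix (Fin n) (Fin n) K) :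
    toBilin (taftK q t) A B = taftTwist q (toBilin t (taftTwist q⁻¹ A) (taftTwist q⁻¹ B)) := by
  ext i j
  simp only [toBilin_apply, taftTwist_apply, taftK_apply, taftWeight_inv, Prod.mk.eta, Finset.mul_sum]
  refine Finset.sum_congr rfl fun b _ => Finset.sum_congr rfl fun c _ => ?_
  ring

/-- Entry formula for `δ` with the indicators written as factors. [folklore] -/
theorem taftSkewDer_apply_boole (q : K) {n : ℕ} (Y : Matrix (Fin n) (Fin n) K) (i j : Fin n) :
    taftSkewDer q Y i j =
      (∑ l : Fin n, (if (l : ℕ) + 1 = (j : ℕ) then (1 : K) else 0) * Y i l) -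
        ∑ l : Fin n, (if (i : ℕ) + 1 = (l : ℕ) then (1 : K) else 0) * (taftWeight q (l, j) * Y l j) := by
  rw [taftSkewDer_apply]
  simp only [boole_mul]

/-- Entry formula for `𝒳` with the indicators written as factors. [folklore] -/
theorem taftX_apply_boole (q : K) {n : ℕ} (t : MatrixTensor K n) (a b c : Fin n × Fin n) :
    taftX q t a b c =
      (taftWeight q b)⁻¹ * (taftWeight q c)⁻¹ *
            ((∑ l : Fin n, (if (l : ℕ) + 1 = (a.2 : ℕ) then (1 : K) else 0) * t (a.1, l) b c) -
              ∑ l : Fin n, (if (a.1 : ℕ) + 1 = (l : ℕ) then (1 : K) else 0) *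
                (taftWeight q (l, a.2) * t (l, a.2) b c)) -
          (taftWeight q b)⁻¹ *
            ((∑ μ : Fin n, (if (b.2 : ℕ) + 1 = (μ : ℕ) then (1 : K) else 0) * t a (b.1, μ) c) -
              ∑ k : Fin n, (if (k : ℕ) + 1 = (b.1 : ℕ) then (1 : K) else 0) *
                (taftWeight q b * t a (k, b.2) c)) -
        (taftWeight q b)⁻¹ * (taftWeight q c)⁻¹ *
          ((∑ μ : Fin n, (if (c.2 : ℕ) + 1 = (μ : ℕ) then (1 : K) else 0) * t a b (c.1, μ)) -
            ∑ k : Fin n, (if (k : ℕ) + 1 = (c.1 : ℕ) then (1 : K) else 0) *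
              (taftWeight q c * t a b (k, c.2))) := by
  simp only [taftX, boole_mul]

section SumPermutations

variable {n : ℕ}

/-- Reordering of a five-fold sum (move the last binder to the front). [folklore] -/
private theorem sum5_rot (f : Fin n → Fin n → Fin n → Fin n → Fin n → K) :
    ∑ a, ∑ b, ∑ c, ∑ d, ∑ e, f a b c d e = ∑ e, ∑ a, ∑ b, ∑ c, ∑ d, f a b c d e := by
  calc ∑ a, ∑ b, ∑ c, ∑ d, ∑ e, f a b c d e
      = ∑ a, ∑ b, ∑ c, ∑ e, ∑ d, f a b c d e :=
        Finset.sum_congr rfl fun _ _ => Finset.sum_congr rfl fun _ _ =>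
          Finset.sum_congr rfl fun _ _ => Finset.sum_comm
    _ = ∑ a, ∑ b, ∑ e, ∑ c, ∑ d, f a b c d e :=
        Finset.sum_congr rfl fun _ _ => Finset.sum_congr rfl fun _ _ => Finset.sum_comm
    _ = ∑ a, ∑ e, ∑ b, ∑ c, ∑ d, f a b c d e := Finset.sum_congr rfl fun _ _ => Finset.sum_comm
    _ = ∑ e, ∑ a, ∑ b, ∑ c, ∑ d, f a b c d e := Finset.sum_comm

/-- Reordering of a five-fold sum (swap binders 4 and 5). [folklore] -/
private theorem sum5_swap45 (f : Fin n → Fin n → Fin n → Fin n → Fin n → K) :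
    ∑ a, ∑ b, ∑ c, ∑ d, ∑ e, f a b c d e = ∑ a, ∑ b, ∑ c, ∑ e, ∑ d, f a b c d e :=
  Finset.sum_congr rfl fun _ _ => Finset.sum_congr rfl fun _ _ =>
    Finset.sum_congr rfl fun _ _ => Finset.sum_comm

/-- Reordering of a five-fold sum (swap binders 3 and 5). [folklore] -/
private theorem sum5_swap35 (f : Fin n → Fin n → Fin n → Fin n → Fin n → K) :
    ∑ a, ∑ b, ∑ c, ∑ d, ∑ e, f a b c d e = ∑ a, ∑ b, ∑ e, ∑ d, ∑ c, f a b c d e := by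
  calc ∑ a, ∑ b, ∑ c, ∑ d, ∑ e, f a b c d e
      = ∑ a, ∑ b, ∑ c, ∑ e, ∑ d, f a b c d e := sum5_swap45 f
    _ = ∑ a, ∑ b, ∑ e, ∑ c, ∑ d, f a b c d e :=
        Finset.sum_congr rfl fun _ _ => Finset.sum_congr rfl fun _ _ => Finset.sum_comm
    _ = ∑ a, ∑ b, ∑ e, ∑ d, ∑ c, f a b c d e :=
        Finset.sum_congr rfl fun _ _ => Finset.sum_congr rfl fun _ _ =>
          Finset.sum_congr rfl fun _ _ => Finset.sum_comm

/-- Reordering of a five-fold sum (swap binders 2 and 5). [folklore] -/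
private theorem sum5_swap25 (f : Fin n → Fin n → Fin n → Fin n → Fin n → K) :
    ∑ a, ∑ b, ∑ c, ∑ d, ∑ e, f a b c d e = ∑ a, ∑ e, ∑ c, ∑ d, ∑ b, f a b c d e := by
  calc ∑ a, ∑ b, ∑ c, ∑ d, ∑ e, f a b c d e
      = ∑ a, ∑ b, ∑ e, ∑ d, ∑ c, f a b c d e := sum5_swap35 f
    _ = ∑ a, ∑ e, ∑ b, ∑ d, ∑ c, f a b c d e := Finset.sum_congr rfl fun _ _ => Finset.sum_comm
    _ = ∑ a, ∑ e, ∑ b, ∑ c, ∑ d, f a b c d e :=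
        Finset.sum_congr rfl fun _ _ => Finset.sum_congr rfl fun _ _ =>
          Finset.sum_congr rfl fun _ _ => Finset.sum_comm
    _ = ∑ a, ∑ e, ∑ c, ∑ b, ∑ d, f a b c d e :=
        Finset.sum_congr rfl fun _ _ => Finset.sum_congr rfl fun _ _ => Finset.sum_comm
    _ = ∑ a, ∑ e, ∑ c, ∑ d, ∑ b, f a b c d e :=
        Finset.sum_congr rfl fun _ _ => Finset.sum_congr rfl fun _ _ =>
          Finset.sum_congr rfl fun _ _ => Finset.sum_comm

/-- Reordering of a five-fold sum (swap binders 1 and 5). [folklore] -/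
private theorem sum5_swap15 (f : Fin n → Fin n → Fin n → Fin n → Fin n → K) :
    ∑ a, ∑ b, ∑ c, ∑ d, ∑ e, f a b c d e = ∑ e, ∑ b, ∑ c, ∑ d, ∑ a, f a b c d e := by
  calc ∑ a, ∑ b, ∑ c, ∑ d, ∑ e, f a b c d e
      = ∑ a, ∑ e, ∑ c, ∑ d, ∑ b, f a b c d e := sum5_swap25 f
    _ = ∑ e, ∑ a, ∑ c, ∑ d, ∑ b, f a b c d e := Finset.sum_comm
    _ = ∑ e, ∑ c, ∑ a, ∑ d, ∑ b, f a b c d e := Finset.sum_congr rfl fun _ _ => Finset.sum_comm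
    _ = ∑ e, ∑ c, ∑ d, ∑ a, ∑ b, f a b c d e :=
        Finset.sum_congr rfl fun _ _ => Finset.sum_congr rfl fun _ _ => Finset.sum_comm
    _ = ∑ e, ∑ c, ∑ d, ∑ b, ∑ a, f a b c d e :=
        Finset.sum_congr rfl fun _ _ => Finset.sum_congr rfl fun _ _ =>
          Finset.sum_congr rfl fun _ _ => Finset.sum_comm
    _ = ∑ e, ∑ c, ∑ b, ∑ d, ∑ a, f a b c d e :=
        Finset.sum_congr rfl fun _ _ => Finset.sum_congr rfl fun _ _ => Finset.sum_comm
    _ = ∑ e, ∑ b, ∑ c, ∑ d, ∑ a, f a b c d e := Finset.sum_congr rfl fun _ _ => Finset.sum_comm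

/-- Termwise equality of five-fold sums. [folklore] -/
private theorem sum5_congr {f g : Fin n → Fin n → Fin n → Fin n → Fin n → K}
    (h : ∀ a b c d e, f a b c d e = g a b c d e) :
    ∑ a, ∑ b, ∑ c, ∑ d, ∑ e, f a b c d e = ∑ a, ∑ b, ∑ c, ∑ d, ∑ e, g a b c d e := by
  simp only [h]

end SumPermutations

/-- `𝒳` is the operator induced by `x`: `f_{𝒳 t}(A, B) = δ(f_t(g⁻¹A, g⁻¹B)) - f_t(δ g⁻¹A, B) - f_t(g⁻¹A, δ g⁻¹B)`
with `g⁻¹ = taftTwist q⁻¹`, `δ = taftSkewDer q` — the index formula of `taftX` is the action of the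
skew-primitive generator on `Hom_K(M_n ⊗ M_n, M_n)`. (Pure reindexing of finite sums; no hypothesis on
`q`.) [folklore] -/
theorem toBilin_taftX (q : K) {n : ℕ} (t : MatrixTensor K n) (A B : Matrix (Fin n) (Fin n) K) :
    toBilin (taftX q t) A B =
      taftSkewDer q (toBilin t (taftTwist q⁻¹ A) (taftTwist q⁻¹ B)) -
        toBilin t (taftSkewDer q (taftTwist q⁻¹ A)) B -
          toBilin t (taftTwist q⁻¹ A) (taftSkewDer q (taftTwist q⁻¹ B)) := by
  ext i j
  simp only [Matrix.sub_apply, toBilin_apply, taftX_apply_boole, taftSkewDer_apply_boole,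
    taftTwist_apply, taftWeight_inv, Prod.mk.eta]
  simp only [mul_sub, sub_mul, Finset.mul_sum, Finset.sum_mul, Finset.sum_sub_distrib]
  simp only [Fintype.sum_prod_type]
  -- the twelve five-fold sums match in pairs after a permutation of the bound indices
  refine congrArg₂ (· - ·) (congrArg₂ (· - ·) (congrArg₂ (· - ·) ?_ ?_) (congrArg₂ (· - ·) ?_ ?_))
    (congrArg₂ (· - ·) ?_ ?_)
  · rw [sum5_rot]
    exact sum5_congr fun _ _ _ _ _ => by ring
  · rw [sum5_rot]
    exact sum5_congr fun _ _ _ _ _ => by ring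
  · rw [sum5_swap25]
    exact sum5_congr fun _ _ _ _ _ => by ring
  · rw [sum5_swap15]
    exact sum5_congr fun _ _ _ _ _ => by ring
  · rw [sum5_swap45]
    exact sum5_congr fun _ _ _ _ _ => by ring
  · rw [sum5_swap35]
    exact sum5_congr fun _ _ _ _ _ => by ring

/-- Consequently the conceptual definitions reproduce the proved identities: e.g. the twisted Leibniz rule
gives `f_{𝒳 ⟨n,n,n⟩} = 0` directly (`q ≠ 0`). [cite: Montgomery1993Hopf, Ex. 4.1.8] -/
theorem toBilin_taftX_matMulTensor {q : K} (hq : q ≠ 0) (n : ℕ) (A B : Matrix (Fin n) (Fin n) K) :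
    toBilin (taftX q (matMulTensor K n n n)) A B = 0 := by
  rw [toBilin_taftX, toBilin_matMulTensor, toBilin_matMulTensor, toBilin_matMulTensor,
    taftSkewDer_mul hq]
  have hg : taftTwist q (taftTwist q⁻¹ B) = B := by
    ext i j
    simp only [taftTwist_apply, taftWeight_inv]
    rw [← mul_assoc, mul_inv_cancel₀ (taftWeight_ne_zero hq _), one_mul]
  rw [hg]
  abel

/-! ## Certificate-shaped predicates used by Taft-stable schemes -/

/-- A finite family of tensors `T : Fin r → K^{(n×n)³}` spans an `op`-stable subspace, in certificate
form: there is a coefficient matrix `c` with `op (T s) = Σ_{s'} c s s' • T s'` for every `s`.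
(For `op = 𝒦, 𝒳` this says the span is a `T_n(q)`-submodule of `Hom(M_n ⊗ M_n, M_n)`.) [folklore] -/
def IsSpanStable {n r : ℕ} (op : MatrixTensor K n → MatrixTensor K n) (T : Fin r → MatrixTensor K n) :
    Prop :=
  ∃ c : Fin r → Fin r → K, ∀ s, op (T s) = ∑ s', c s s' • T s'

/-- A rank-one tensor (seed) `t` is Taft-CLOSED: `𝒳 t` lies in the span of its `⟨𝒦⟩`-orbit
`𝒦⁰ t, …, 𝒦ⁿ⁻¹ t` (with explicit coefficients), so that the orbit spans a `T_n(q)`-submodule. [folklore] -/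
def IsTaftClosedSeed (q : K) {n : ℕ} (t : MatrixTensor K n) : Prop :=
  ∃ c : Fin n → K, taftX q t = ∑ k : Fin n, c k • (taftK q)^[(k : ℕ)] t

/-- A tensor is Taft-INVARIANT: `𝒦 t = t` and `𝒳 t = 0` (e.g. `⟨n,n,n⟩` itself, `taftK_matMulTensor`,
`taftX_matMulTensor`). [folklore] -/
def IsTaftInvariant (q : K) {n : ℕ} (t : MatrixTensor K n) : Prop :=
  taftK q t = t ∧ taftX q t = 0

/-- A TAFT-STABLE SCHEME of length `r` for `n × n` matrix multiplication: a decomposition of `⟨n,n,n⟩`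
into `r` triads `w s ⊗ u s ⊗ v s` whose span is carried into itself by `𝒦` and by `𝒳` (a
`T_n(q)`-submodule of `Hom(M_n ⊗ M_n, M_n)` spanned by rank-one tensors summing to matrix multiplication).
For `K = ℂ`, `q = rootOfUnity n` this is definitionally the `let St` of route
`MatrixMultiplication/TaftSchemes`. [folklore] -/
def IsTaftStableScheme (q : K) (n r : ℕ) (w u v : Fin r → Fin n × Fin n → K) : Prop :=
  matMulTensor K n n n = ∑ s, triad (w s) (u s) (v s) ∧
    IsSpanStable (taftK q) (fun s => triad (w s) (u s) (v s)) ∧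
      IsSpanStable (taftX q) (fun s => triad (w s) (u s) (v s))

/-- Matrix multiplication itself is Taft-invariant (`q ≠ 0`). [cite: Montgomery1993Hopf, Def. 4.1.1] -/
theorem isTaftInvariant_matMulTensor {q : K} (hq : q ≠ 0) (n : ℕ) :
    IsTaftInvariant q (matMulTensor K n n n) :=
  ⟨taftK_matMulTensor hq n, taftX_matMulTensor hq n⟩

/-- A Taft-stable scheme of length `r` bounds the rank: `R(⟨n,n,n⟩) ≤ r`. [folklore] -/
theorem IsTaftStableScheme.tensorRank_le {q : K} {n r : ℕ} {w u v : Fin r → Fin n × Fin n → K}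
    (h : IsTaftStableScheme q n r w u v) : tensorRank (matMulTensor K n n n) ≤ r :=
  tensorRank_le_of_eq_sum w u v h.1

/-! ## The complex parameter `ω_n = e^{2πi/n}` -/

/-- The standard primitive `n`-th root of unity `ω_n = exp(2πi/n) ∈ ℂ`, the Taft parameter at which the
route `MatrixMultiplication/TaftSchemes` works (`ω_2 = -1`: Sweedler's `H_4`). For `n = 0` this is the
junk value `exp 0 = 1`. [folklore] -/
def rootOfUnity (n : ℕ) : ℂ :=
  Complex.exp (2 * Real.pi * Complex.I / n)

/-- Unfolding of `rootOfUnity`. [folklore] -/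
theorem rootOfUnity_def (n : ℕ) : rootOfUnity n = Complex.exp (2 * Real.pi * Complex.I / n) := rfl

/-- `ω_n` is a primitive `n`-th root of unity (`n ≠ 0`; Mathlib's `Complex.isPrimitiveRoot_exp`). [folklore] -/
theorem isPrimitiveRoot_rootOfUnity {n : ℕ} (hn : n ≠ 0) : IsPrimitiveRoot (rootOfUnity n) n :=
  Complex.isPrimitiveRoot_exp n hn

/-- `ω_n ≠ 0`. [folklore] -/
theorem rootOfUnity_ne_zero (n : ℕ) : rootOfUnity n ≠ 0 :=
  Complex.exp_ne_zero _

/-- `ω_nⁿ = 1` (for `n = 0` both sides are `1`). [folklore] -/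
theorem rootOfUnity_pow_self (n : ℕ) : rootOfUnity n ^ n = 1 := by
  rcases Nat.eq_zero_or_pos n with rfl | hn
  · simp
  · exact (isPrimitiveRoot_rootOfUnity hn.ne').pow_eq_one

/-- Over `ℂ` at `q = ω_n`: `𝒦ⁿ = id`. [folklore] -/
theorem taftK_rootOfUnity_iterate_self (n : ℕ) (t : MatrixTensor ℂ n) :
    (taftK (rootOfUnity n))^[n] t = t :=
  taftK_iterate_self (rootOfUnity_pow_self n) t

/-- Over `ℂ` at `q = ω_n`: matrix multiplication is Taft-invariant, `𝒦 ⟨n,n,n⟩ = ⟨n,n,n⟩` and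
`𝒳 ⟨n,n,n⟩ = 0`. [cite: Montgomery1993Hopf, Def. 4.1.1] -/
theorem taftK_taftX_matMulTensor_complex (n : ℕ) :
    taftK (rootOfUnity n) (matMulTensor ℂ n n n) = matMulTensor ℂ n n n ∧
      taftX (rootOfUnity n) (matMulTensor ℂ n n n) = 0 :=
  ⟨taftK_matMulTensor (rootOfUnity_ne_zero n) n, taftX_matMulTensor (rootOfUnity_ne_zero n) n⟩

/-- Over `ℂ` at `q = ω_n`: `𝒳 𝒦 = ω_n · 𝒦 𝒳`. [cite: MontgomerySchneider2001, (1.1)] -/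
theorem taftX_taftK_complex {n : ℕ} (t : MatrixTensor ℂ n) :
    taftX (rootOfUnity n) (taftK (rootOfUnity n) t) =
      rootOfUnity n • taftK (rootOfUnity n) (taftX (rootOfUnity n) t) :=
  taftX_taftK (rootOfUnity_ne_zero n) t

end Literature.RingTheory.HopfActions

end
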